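import Summits.Ventures.HodgeRepro2.T5QuadraticInertCriterion
import Mathlib.RingTheory.DedekindDomain.Different

/-!
# T5QuadraticConductor — the conductor of `𝓞_K[√d]` contains `2√d` and `4d`:
# the census of the inert places with the single side condition «`v ∤ 4d`»

Tier-5 kernel support (seat p8, blind lane; sub-step N3, the census of the datum's places).
T5-173 (`T5QuadraticInertCriterion`) carried the Kummer–Dedekind coprimality
`(conductor (𝓞 K) x).comap (algebraMap _ _) ⊔ v.asIdeal = ⊤` as a hypothesis.  Here it is
discharged from Mathlib's `conductor_mul_differentIdeal`
(`conductor 𝓞_K x · 𝔇_{L/K} = (f'(x))`, `f = minpoly 𝓞_K x`): for `f = X² − d` the derivative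
value `f'(x) = 2x` lies in the conductor, hence so does `(2x)² = 4d`, and a finite place `v`
of `K` with `4d ∉ v` is coprime to the conductor.  Consequences, for `L/K` quadratic,
`x ∈ 𝓞_L` with `x² = d ∈ 𝓞_K`, `x ∉ 𝓞_K`:

* `adjoin_eq_top` — `L = K(x)`;
* `two_mul_mem_conductor`, `algebraMap_four_mul_mem_conductor` — `2x, 4d ∈ conductor 𝓞_K x`;
* `comap_conductor_sup_eq_top` — `v ∤ 4d ⇒` the coprimality hypothesis of T5-173;
* `isPrime_map_iff_not_isSquare` / `exists_map_eq_asIdeal_iff_not_isSquare` — **the census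
  with the single side condition `4d ∉ v`**: `v` stays prime in `L = K(√d)` iff `d` is not a
  square in `𝓞_K ⧸ v`;
* `heckeAlgebra_mul_comm_of_not_isSquare` — the inert-place package (T5-158) at every such `v`.

No `sorry`, no axiom beyond `propext`, `Classical.choice`, `Quot.sound`.
-/

namespace Summit.Ventures.HodgeRepro2.T5QuadraticConductor

open Polynomial NumberField IsDedekindDomain HeightOneSpectrum

variable {K : Type*} [Field K] [NumberField K] {L : Type*} [Field L] [NumberField L] [Algebra K L]
  {x : 𝓞 L} {d : 𝓞 K}

/-- `L = K(x)` when `[L : K] = 2` and `minpoly (𝓞 K) x = X ^ 2 - C d`. -/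
theorem adjoin_eq_top (h2 : Module.finrank K L = 2) (hmin : minpoly (𝓞 K) x = X ^ 2 - C d) :
    Algebra.adjoin K {algebraMap (𝓞 L) L x} = ⊤ := by
  have hAx : IsIntegral (𝓞 K) x := Algebra.IsIntegral.isIntegral x
  have hKx : IsIntegral K (algebraMap (𝓞 L) L x) := Algebra.IsIntegral.isIntegral _
  have hdeg : (minpoly K (algebraMap (𝓞 L) L x)).natDegree = 2 := by
    rw [minpoly.isIntegrallyClosed_eq_field_fractions K L hAx, (minpoly.monic hAx).natDegree_map,
      hmin, natDegree_X_pow_sub_C]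
  have htop : IntermediateField.adjoin K {algebraMap (𝓞 L) L x} = ⊤ := by
    refine IntermediateField.eq_of_le_of_finrank_eq le_top ?_
    rw [IntermediateField.adjoin.finrank hKx, hdeg, IntermediateField.finrank_top', h2]
  rw [← IntermediateField.adjoin_simple_toSubalgebra_of_isAlgebraic hKx.isAlgebraic, htop,
    IntermediateField.top_toSubalgebra]

/-- The derivative value `f'(x)` of the minimal polynomial lies in the conductor of `𝓞_K[x]`
(Mathlib's `conductor_mul_differentIdeal`: `conductor · 𝔇 = (f'(x))`). -/
theorem aeval_derivative_minpoly_mem_conductor (h2 : Module.finrank K L = 2)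
    (hmin : minpoly (𝓞 K) x = X ^ 2 - C d) :
    aeval x (derivative (minpoly (𝓞 K) x)) ∈ conductor (𝓞 K) x := by
  have h := conductor_mul_differentIdeal (𝓞 K) K L x (adjoin_eq_top h2 hmin)
  have hmem : aeval x (derivative (minpoly (𝓞 K) x)) ∈
      conductor (𝓞 K) x * differentIdeal (𝓞 K) (𝓞 L) := by
    rw [h]
    exact Ideal.mem_span_singleton_self _
  exact Ideal.mul_le_right hmem

/-- `2x ∈ conductor 𝓞_K x` for `minpoly (𝓞 K) x = X ^ 2 - C d`. -/
theorem two_mul_mem_conductor (h2 : Module.finrank K L = 2)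
    (hmin : minpoly (𝓞 K) x = X ^ 2 - C d) : 2 * x ∈ conductor (𝓞 K) x := by
  have h := aeval_derivative_minpoly_mem_conductor h2 hmin
  rw [hmin, derivative_sub, derivative_X_pow, derivative_C, sub_zero] at h
  have e : aeval x (C ((2 : ℕ) : 𝓞 K) * X ^ (2 - 1)) = 2 * x := by
    rw [map_mul, aeval_C, map_natCast, map_pow, aeval_X]
    norm_num
  rwa [e] at h

/-- `4d ∈ conductor 𝓞_K x` (as `(2x)² = 4x² = 4d`). -/
theorem algebraMap_four_mul_mem_conductor (h2 : Module.finrank K L = 2)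
    (hx : x * x = algebraMap (𝓞 K) (𝓞 L) d) (hmin : minpoly (𝓞 K) x = X ^ 2 - C d) :
    algebraMap (𝓞 K) (𝓞 L) (4 * d) ∈ conductor (𝓞 K) x := by
  have h := Ideal.mul_mem_left (conductor (𝓞 K) x) (2 * x) (two_mul_mem_conductor h2 hmin)
  convert h using 1
  rw [map_mul, map_ofNat, ← hx]
  ring

/-- `4d ∈ (conductor 𝓞_K x).comap (algebraMap 𝓞_K 𝓞_L)`. -/
theorem four_mul_mem_comap_conductor (h2 : Module.finrank K L = 2)
    (hx : x * x = algebraMap (𝓞 K) (𝓞 L) d) (hmin : minpoly (𝓞 K) x = X ^ 2 - C d) :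
    4 * d ∈ (conductor (𝓞 K) x).comap (algebraMap (𝓞 K) (𝓞 L)) :=
  Ideal.mem_comap.mpr (algebraMap_four_mul_mem_conductor h2 hx hmin)

/-- A finite place `v` of `K` with `4d ∉ v` is coprime to the conductor of `𝓞_K[x]`: the
Kummer–Dedekind hypothesis of T5-172 / T5-173. -/
theorem comap_conductor_sup_eq_top (h2 : Module.finrank K L = 2)
    (hx : x * x = algebraMap (𝓞 K) (𝓞 L) d) (hmin : minpoly (𝓞 K) x = X ^ 2 - C d)
    (v : HeightOneSpectrum (𝓞 K)) (hv : 4 * d ∉ v.asIdeal) :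
    (conductor (𝓞 K) x).comap (algebraMap (𝓞 K) (𝓞 L)) ⊔ v.asIdeal = ⊤ := by
  by_contra hne
  have heq := v.isMaximal.eq_of_le hne le_sup_right
  exact hv (heq ▸ Ideal.mem_sup_left (four_mul_mem_comap_conductor h2 hx hmin))

section Census

variable (v : HeightOneSpectrum (𝓞 K)) (h2 : Module.finrank K L = 2)
  (hx : x * x = algebraMap (𝓞 K) (𝓞 L) d) (hx' : x ∉ Set.range (algebraMap (𝓞 K) (𝓞 L)))
  (hv : 4 * d ∉ v.asIdeal)

include h2 hx hx' hv

/-- **The census of the inert places of `L = K(√d)`**: for a finite place `v` of `K` with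
`4d ∉ v`, the ideal `v 𝓞_L` is prime iff `d` is not a square in `𝓞_K ⧸ v`. -/
theorem isPrime_map_iff_not_isSquare :
    (v.asIdeal.map (algebraMap (𝓞 K) (𝓞 L))).IsPrime ↔
      ¬ IsSquare (Ideal.Quotient.mk v.asIdeal d) :=
  T5QuadraticInertCriterion.isPrime_map_iff_not_isSquare v
    (comap_conductor_sup_eq_top h2 hx (T5QuadraticInertCriterion.minpoly_eq_X_sq_sub_C hx hx') v hv)
    (T5QuadraticInertCriterion.minpoly_eq_X_sq_sub_C hx hx')

/-- The census in the vocabulary of T5-157 / T5-158: «`v` stays prime in `L`» iff `d` is not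
a square modulo `v` (for `4d ∉ v`). -/
theorem exists_map_eq_asIdeal_iff_not_isSquare :
    (∃ w : HeightOneSpectrum (𝓞 L), v.asIdeal.map (algebraMap (𝓞 K) (𝓞 L)) = w.asIdeal) ↔
      ¬ IsSquare (Ideal.Quotient.mk v.asIdeal d) :=
  T5QuadraticInertCriterion.exists_map_eq_asIdeal_iff_not_isSquare v
    (comap_conductor_sup_eq_top h2 hx (T5QuadraticInertCriterion.minpoly_eq_X_sq_sub_C hx hx') v hv)
    (T5QuadraticInertCriterion.minpoly_eq_X_sq_sub_C hx hx')

/-- `d` not a square modulo `v` (`4d ∉ v`) ⇒ `v 𝓞_L = w` for every place `w ∣ v`. -/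
theorem map_eq_asIdeal_of_not_isSquare (hd : ¬ IsSquare (Ideal.Quotient.mk v.asIdeal d))
    (w : HeightOneSpectrum (𝓞 L)) [w.asIdeal.LiesOver v.asIdeal] :
    v.asIdeal.map (algebraMap (𝓞 K) (𝓞 L)) = w.asIdeal :=
  T5QuadraticInertCriterion.map_eq_asIdeal_of_isPrime_map v
    ((isPrime_map_iff_not_isSquare v h2 hx hx' hv).mpr hd) w

/-- `d` not a square modulo `v` (`4d ∉ v`) ⇒ `[L_w : K_v] = 2` (T5-157). -/
theorem finrank_adicCompletion_eq_two_of_not_isSquare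
    (hd : ¬ IsSquare (Ideal.Quotient.mk v.asIdeal d))
    (w : HeightOneSpectrum (𝓞 L)) [w.asIdeal.LiesOver v.asIdeal] :
    Module.finrank (v.adicCompletion K) (w.adicCompletion L) = 2 :=
  T5InertGlobalPrime.finrank_adicCompletion_eq_two_of_staysPrime v w h2
    (map_eq_asIdeal_of_not_isSquare v h2 hx hx' hv hd w)

/-- `d` not a square modulo `v` (`4d ∉ v`) ⇒ the spherical Hecke algebra `H(U(H), K_H)` of the
record's local unitary group at `v` is commutative (T5-158; the star is T5-125's
`starRingOfQuadratic` on the derived `[L_w : K_v] = 2`). -/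
theorem heckeAlgebra_mul_comm_of_not_isSquare (hd : ¬ IsSquare (Ideal.Quotient.mk v.asIdeal d))
    (w : HeightOneSpectrum (𝓞 L)) [w.asIdeal.LiesOver v.asIdeal]
    {ϖ : v.adicCompletionIntegers K} (hϖ : Irreducible ϖ)
    (σ : Gal(w.adicCompletion L/v.adicCompletion K)) (hσ : σ ≠ 1)
    (H : Matrix (Fin 3) (Fin 3) (w.adicCompletion L)) (k : Type*) [Field k] :
    letI := T5StarOfInvolution.starRingOfQuadratic
      (finrank_adicCompletion_eq_two_of_not_isSquare v h2 hx hx' hv hd w) σ hσ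
    H.IsHermitian →
    (∀ i j, IsLocalization.IsInteger
      (integralClosure (v.adicCompletionIntegers K) (w.adicCompletion L)) (H i j)) →
    IsUnit H.det →
    (∀ i j, IsLocalization.IsInteger
      (integralClosure (v.adicCompletionIntegers K) (w.adicCompletion L)) (H⁻¹ i j)) →
    ∀ T S : T5HeckePermutationModule.heckeAlgebra k
      (T5UnitaryHeckeAdjoint.hyperspecialSubgroup
        (integralClosure (v.adicCompletionIntegers K) (w.adicCompletion L)) H),
    T * S = S * T := by
  intro hH hint hdet hinv T S
  exact T5InertPlaceGlobalPackage.heckeAlgebra_mul_comm_of_staysPrime v w h2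
    (map_eq_asIdeal_of_not_isSquare v h2 hx hx' hv hd w) hϖ σ hσ H k hH hint hdet hinv T S

end Census

end Summit.Ventures.HodgeRepro2.T5QuadraticConductor
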